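import Summits.CriticalPhenomena.SAWScalingLimit.Theses.SAWTrackTransport
import HarnessLib

/-!
# Sketch — crux-ideate round 1 (ideator 2) for `SAWTrackTransport.AxiomsOfLimit` (stmt-CriticalPhenomena-16965)

First lemmas of the two crux ideas filed from this seat:

* `intrinsic-clock-kernel` — the Markov kernel of the limit built ABSTRACTLY as the Doob–Knight
  left-prediction kernel of `P D` along an intrinsic (reparametrisation-invariant) clock on simple
  curves: `exists_canonicalKernel` (statement; XL formalisation, zero research content) — the
  `markov` clause of `IsMarkovExtension` for EVERY closed `F`, plus tip continuity along thickening
  pasts, for ANY law carried by simple curves.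
* `sleeve-inheritance` — the restriction-kernel clause propagates down the inclusion order of pinned
  sub-domains using only `P.IsRestriction`: `restrictionClause_inherit` (PROVED here), plus the
  abstract profile-tuning lemma `exists_profile_le` (stated).
* `UniformVanishingPrefix` — a typed NECESSARY special case of line `tip_kernel`'s S5
  (`IsFutureKernel` (i) at the TRIVIAL past): the cheapest sub-statement of S5 a disprover can
  attack; NOT claimed sufficient for (iii) (see card `sleeve-inheritance`, §Barriers: the residual of
  the kernel clause is a germ statement needing pointwise tip access + near-tip non-hugging).
-/

noncomputable section

open scoped Topology ENNReal NNReal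
open MeasureTheory Filter Set
open Literature.Probability.RandomPlanarGeometry
open Literature.Probability.RandomPlanarGeometry.SAW.YangBaxter
open Literature.Probability.LatticeModels (polyline)

namespace Summit.CriticalPhenomena.SAWScalingLimit.Cruxes.AxiomsOfLimit.Ideate2

/-! ### Card `intrinsic-clock-kernel`: the canonical (left-prediction) kernel -/

/-- **Canonical Markov kernel of a law on simple curves (first lemma of `intrinsic-clock-kernel`).**
For every probability measure `μ` on unparametrised planar curves carried by simple curves there is
ONE measurable sub-probability kernel `Q` on pasts such that, for EVERY closed `F ⊆ ℂ`, `Q ∘ stopAt F`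
is a regular conditional law of the final segment `startFrom F` given the initial segment `stopAt F`
(the `markov` clause of `ChordalFamily.IsMarkovExtension`, all closed `F` at once), AND `Q` is
tip-continuous along the announcing pasts `stopAt (cthickening (1/(n+1)) F) γ → stopAt F γ` for
`μ`-a.e. `γ` (Lévy upward along the announcing sequence). Construction: parametrise each simple curve
by the intrinsic clock `T(p) = Σ 2⁻ⁿ min(1, depthₙ p)` (a continuous functional of the initial segment,
strictly increasing along simple curves), take versions `h_q` of `μ[g(whole curve) | 𝓕_q]`, `q ∈ ℚ`,
and set `Q(p) := lim_{q ↑ T(p), q ∈ ℚ} h_q(p_{≤ q})` (left limits of the rational martingale skeleton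
exist a.s. at every time by upcrossings; at the predictable hitting time `τ_F`, announced by the
thickening hitting times, the left limit is `μ[· | 𝓕_{τ_F−}] = μ[· | σ(stopAt F)]` by optional
sampling at the announcing times and Lévy's upward theorem; `𝓕_{τ_F−} = σ(stopAt F γ)` because the
clock is intrinsic). Dellacherie–Meyer, *Probabilités et potentiel* B, VI.43–45 (predictable
projection); Kallenberg, *Foundations of Modern Probability* (3rd ed.) Lemma 25.2–25.3, Thm 9.28;
P.-A. Meyer, *La théorie de la prédiction de F. Knight*, Sém. Prob. X (1976). [folklore] -/
theorem exists_canonicalKernel (μ : Measure (CurveClass ℂ)) [IsProbabilityMeasure μ]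
    (hμ : ∀ᵐ γ ∂μ, γ ∈ CurveClass.simple) :
    ∃ Q : CurveClass ℂ → Measure (CurveClass ℂ), Measurable Q ∧ (∀ p, Q p Set.univ ≤ 1) ∧
      (∀ F : Set ℂ, IsClosed F → ∀ S T : Set (CurveClass ℂ), MeasurableSet S → MeasurableSet T →
        μ (CurveClass.stopAt F ⁻¹' S ∩ CurveClass.startFrom F ⁻¹' T) =
          ∫⁻ γ in CurveClass.stopAt F ⁻¹' S, Q (γ.stopAt F) T ∂μ) ∧
      (∀ F : Set ℂ, IsClosed F → ∀ g : BoundedContinuousFunction (CurveClass ℂ) ℝ, ∀ᵐ γ ∂μ,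
        Tendsto (fun n : ℕ => ∫ η, g η ∂(Q (γ.stopAt (Metric.cthickening (1 / ((n : ℝ) + 1)) F))))
          atTop (𝓝 (∫ η, g η ∂(Q (γ.stopAt F))))) := by
  sorry

/-! ### Card `sleeve-inheritance`: the kernel clause descends to pinned sub-domains -/

/-- **Inheritance of the restriction-kernel clause (first lemma of `sleeve-inheritance`, PROVED).**
If a measure `ν` on futures (think: the canonical conditional law of the future given a past `p`)
satisfies the restriction-kernel clause at the pinned Dobrushin domain `D₁` —
`P D₁ (T) · ν {γ ⊆ D̄₁} = ν (T ∩ {γ ⊆ D̄₁})` — then it satisfies the clause at EVERY Dobrushin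
`D' ⊆ D₁` with the same marked points, using nothing but the two-sided restriction property of `P`
(product form, no division: `ν(T ∩ E') = P D₁(T ∩ E') ν(E₁) = P D'(T) P D₁(E') ν(E₁) = P D'(T) ν(E')`).
Consequence: `ChordalFamily.IsRestrictionKernel` needs the clause only on a family of pinned
sub-domains that is cofinal under inclusion up to `ν`-null sets (the sleeve complements of the card).
[cite: LawlerSchrammWerner2003Restriction, §3] -/
theorem restrictionClause_inherit {P : ChordalFamily} (hP : P.IsRestriction)
    (ν : Measure (CurveClass ℂ)) {D₁ D' : DobrushinDomain} (hsub : D'.carrier ⊆ D₁.carrier)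
    (h0 : D'.pt 0 = D₁.pt 0) (h1 : D'.pt 1 = D₁.pt 1)
    (hclause : ∀ T : Set (CurveClass ℂ), MeasurableSet T →
      P D₁ T * ν (CurveClass.rangeSubset (closure D₁.carrier)) =
        ν (T ∩ CurveClass.rangeSubset (closure D₁.carrier))) :
    ∀ T : Set (CurveClass ℂ), MeasurableSet T →
      P D' T * ν (CurveClass.rangeSubset (closure D'.carrier)) =
        ν (T ∩ CurveClass.rangeSubset (closure D'.carrier)) := by
  set E₁ : Set (CurveClass ℂ) := CurveClass.rangeSubset (closure D₁.carrier) with hE₁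
  set E' : Set (CurveClass ℂ) := CurveClass.rangeSubset (closure D'.carrier) with hE'
  have hE : E' ⊆ E₁ := fun γ hγ => Set.Subset.trans hγ (closure_mono hsub)
  have hE'm : MeasurableSet E' := CurveClass.measurableSet_rangeSubset isClosed_closure
  intro T hT
  -- the clause at `D₁` on the events `T ∩ E'` and `E'`
  have hTE : ν (T ∩ E') = P D₁ (T ∩ E') * ν E₁ := by
    have h := hclause (T ∩ E') (hT.inter hE'm)
    rw [Set.inter_assoc, Set.inter_eq_left.2 hE] at h
    exact h.symm
  have hEE : ν E' = P D₁ E' * ν E₁ := by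
    have h := hclause E' hE'm
    rw [Set.inter_eq_left.2 hE] at h
    exact h.symm
  -- two-sided restriction of `P` for the pair `D' ⊆ D₁`
  have hres : P D' T * P D₁ E' = P D₁ (T ∩ E') := hP D₁ D' hsub h0 h1 T hT
  rw [hEE, hTE, ← hres, mul_assoc]

/-! ### A typed necessary special case of S5: prefix-insensitivity at the TRIVIAL past -/

/-- `RL α P` — verbatim the `let RL` of the route items (robust full limit on the rhombic tiling of
angle `α`). [cite: GlazmanManolescu2019, §1] -/
def RL (α : ℝ) (P : ChordalFamily) : Prop :=
  ∀ (D : DobrushinDomain) (u : ℝ → ℂ) (a b : ℝ → MidEdge), (∀ᶠ δ in 𝓝[>] (0 : ℝ), ‖u δ‖ ≤ δ) →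
    (∀ᶠ δ in 𝓝[>] (0 : ℝ), Nonempty (YangBaxterSAW (fun (_ : ℤ) => α)
      ((D.map (similarity 1 one_ne_zero (u δ))).carrier) δ (a δ) (b δ))) →
    Tendsto (fun δ : ℝ => (δ : ℂ) * planeMidpoint (fun (_ : ℤ) => α) (a δ)) (𝓝[>] (0 : ℝ)) (𝓝 (D.pt 0)) →
    Tendsto (fun δ : ℝ => (δ : ℂ) * planeMidpoint (fun (_ : ℤ) => α) (b δ)) (𝓝[>] (0 : ℝ)) (𝓝 (D.pt 1)) →
    TendstoLaw
      (fun δ (γ : YangBaxterSAW (fun (_ : ℤ) => α) ((D.map (similarity 1 one_ne_zero (u δ))).carrier) δ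
        (a δ) (b δ)) => γ.curve (fun (_ : ℤ) => α) δ)
      (fun δ => ybLaw (fun (_ : ℤ) => α) ((D.map (similarity 1 one_ne_zero (u δ))).carrier) δ 1 (a δ) (b δ))
      id (P D)

section Lattice
variable {Θ : ℤ → ℝ} {Ω : Set ℂ} {δ : ℝ} {a b : MidEdge}

/-- The cylinder of a lattice prefix (verbatim line `tip_kernel` §2). [cite: LawlerSchrammWerner2004SAW, §2.3] -/
def prefixEvent (ω : List MidEdge) : Set (YangBaxterSAW Θ Ω δ a b) :=
  {γ | ω <+: γ.mids}

/-- The future of a walk after its first `k` mid-edges, drawn at mesh `δ` (verbatim `tip_kernel` §2).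
[cite: LawlerSchrammWerner2004SAW, §2.3] -/
def futureCurve (Θ : ℤ → ℝ) (δ : ℝ) (k : ℕ) (γ : YangBaxterSAW Θ Ω δ a b) : CurveClass ℂ :=
  CurveClass.mk ⟨polyline ((γ.mids.drop k).map fun e => (δ : ℂ) * planeMidpoint Θ e)⟩

/-- The conditional law of the future given the lattice prefix `ω` (cylinder conditioning; verbatim
`tip_kernel` §2). [cite: LawlerSchrammWerner2004SAW, §2.3] -/
def futureLaw (Θ : ℤ → ℝ) (Ω : Set ℂ) (δ : ℝ) (a b : MidEdge) (ω : List MidEdge) :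
    Measure (CurveClass ℂ) :=
  (ProbabilityTheory.cond (ybLaw Θ Ω δ 1 a b) (prefixEvent ω)).map (futureCurve Θ δ (ω.length - 1))

end Lattice

/-- **(UVP) Uniform vanishing-prefix insensitivity — a necessary special case of `tip_kernel` S5.** For the robust limit
`P` of the critical square-tiling Yang–Baxter walk: in every Dobrushin domain `J`, along every
admissible endpoint family `(x_δ, b_δ)` and EVERY family of charged lattice prefixes `ϖ_δ` issued from
`x_δ` whose drawn diameter tends to `0`, the conditional law of the future given the prefix converges
to `P J` itself. This is line `tip_kernel`'s `IsFutureKernel` clause (i) restricted to the TRIVIAL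
continuum past (`kernelOf Φ J (const a) = P J`); "uniform" = "every family `ϖ_δ`". Kennedy–Lawler's
endpoint-factorisation conjecture in law form. [cite: KennedyLawler2013, §2] -/
def UniformVanishingPrefix : Prop :=
  ∀ (P : ChordalFamily) (J : DobrushinDomain) (x b : ℝ → MidEdge) (ϖ : ℝ → List MidEdge) (η : ℝ → ℝ),
    P.IsChordal → RL (Real.pi / 2) P →
    (∀ᶠ δ in 𝓝[>] (0 : ℝ), Nonempty (YangBaxterSAW (fun (_ : ℤ) => Real.pi / 2) J.carrier δ (x δ) (b δ))) →
    Tendsto (fun δ : ℝ => (δ : ℂ) * planeMidpoint (fun (_ : ℤ) => Real.pi / 2) (x δ)) (𝓝[>] (0 : ℝ))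
      (𝓝 (J.pt 0)) →
    Tendsto (fun δ : ℝ => (δ : ℂ) * planeMidpoint (fun (_ : ℤ) => Real.pi / 2) (b δ)) (𝓝[>] (0 : ℝ))
      (𝓝 (J.pt 1)) →
    (∀ᶠ δ in 𝓝[>] (0 : ℝ),
      ybLaw (fun (_ : ℤ) => Real.pi / 2) J.carrier δ 1 (x δ) (b δ) (prefixEvent (ϖ δ)) ≠ 0) →
    (∀ᶠ δ in 𝓝[>] (0 : ℝ), (ϖ δ).head? = some (x δ)) →
    Tendsto η (𝓝[>] (0 : ℝ)) (𝓝 0) →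
    (∀ᶠ δ in 𝓝[>] (0 : ℝ), ∀ e ∈ ϖ δ,
      ‖(δ : ℂ) * planeMidpoint (fun (_ : ℤ) => Real.pi / 2) e -
        (δ : ℂ) * planeMidpoint (fun (_ : ℤ) => Real.pi / 2) (x δ)‖ ≤ η δ) →
    TendstoLaw (fun (_ : ℝ) (c : CurveClass ℂ) => c)
      (fun δ => futureLaw (fun (_ : ℤ) => Real.pi / 2) J.carrier δ (x δ) (b δ) (ϖ δ)) id (P J)

/-- **Profile tuning (abstract; second lemma of `sleeve-inheritance`, provable now).** For any finite
measure and any sequence of a.e. positive random levels `d j` (think: the minimal distance of the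
future to the past on the `j`-th dyadic shell around the tip), there is ONE deterministic positive
profile `c` dominated by the random one outside a set of measure `≤ ε` — so a countable family of
sleeves "thinner than `ν_p`-almost every future" exists. Union bound over `j` with `ν{d j < c j} ≤ ε 2⁻ʲ`.
[folklore] -/
theorem exists_profile_le {X : Type*} [MeasurableSpace X] (ν : Measure X) [IsFiniteMeasure ν]
    (d : ℕ → X → ℝ) (hd : ∀ j, Measurable (d j)) (hpos : ∀ j, ∀ᵐ x ∂ν, 0 < d j x) {ε : ℝ≥0∞}
    (hε : 0 < ε) :
    ∃ c : ℕ → ℝ, (∀ j, 0 < c j) ∧ ν {x | ∃ j, d j x < c j} ≤ ε := by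
  sorry

end Summit.CriticalPhenomena.SAWScalingLimit.Cruxes.AxiomsOfLimit.Ideate2

end
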